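import Summits.BirchSwinnertonDyer.Rank1Residual.P2.CongruentNumberPairsAtTwoUPlusSix
import Summits.BirchSwinnertonDyer.Rank1Residual.P2.CongruentNumberPairsAtTwoThreeSevenFamily
import Literature.NumberTheory.EllipticCurves.TianYuanZhang2017.UPlusOfGenusPointData
import HarnessLib

/-!
# Sub-lane «bsd-p2»: the `ρ`-FREE DOORS at `2` with U⁺ DISCHARGED — DOOR A (classes `5`, `7`), DOOR B6
# (class `6`), DOOR C6 (Tian's 2014 class-`6` family) modulo {TYZ §3 displayed (`tyz_genusPointData`),
# GZK, Monsky 1994 / Tian 2014 Thm 1.3 + Rédei–Reichardt} — p2-lead L1-65 (3) / T-92 (the count-moving twins)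

HONEST FRAMING (sub-lane «bsd-p2», run/shared/lean/b2b/bsd-rank1-residual/p2/, verbatim in every
file): the target of record is the FULL Birch–Swinnerton-Dyer formula for EVERY analytic-rank `≤ 1`
`E/ℚ` at ALL primes INCLUDING `2`; the odd-prime class ledger is referee A's; the `2`-part is OPEN
(cells O1 = X5 ∖ CM and O12 = the CM corner) and under census by «bsd-p2». Census / instrument
output at `2` = EVIDENCE / conjecture items with held-out validation, NEVER a Literature fact;
certificates close PAIRS (one isogeny class, `p = 2`), never classes. This file asserts NO
arithmetic fact. WHAT IT DOES. `P2/CongruentNumberPairsAtTwoUPlus.lean` / `…UPlusSix.lean` (p2-typer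
GEN 5) typed the `ρ`-free doors A / B6 / C6 with the parity statement U⁺ as a HYPOTHESIS `hU` in tree
currency. p2-monsky-lit's W2 composition `W2.uPlus_genusField_of (hTYZ : tyz_genusPointData)
(hGZK : rank_eq_analyticRank_of_analyticRank_le_one)` (file `TianYuanZhang2017/UPlusOfGenusPointData.lean`)
PROVES U⁺ in the kernel modulo p2-lit-1's DISPLAYED printed statements of Tian–Yuan–Zhang §3 (ONE named
fact `tyz_genusPointData`: Prop. 3.4, Thm. 3.5 main clause, Lemma 3.18, the Galois facts on `β′`,
Lemma 3.21) and GZK. THIS FILE discharges `hU` BY NAME (`uPlus_of_genusPointData` = the composition with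
lit-1's `gK d` unfolded to `genusClassNumber (GenusField d)`, a `rfl`-transport) and records the twins:
* DOOR A `bsdp_two_congruentNumberCurve_of_genusPointData` (+ the rank/Ш conjunction): `n = p₁⋯p_k ≡ 5, 7
  (mod 8)`, Monsky odd kernel count `2`, `Σ₁` odd or `Σ₂′` odd ⟹ `BSD(E_n, 2)` modulo {`tyz_genusPointData`,
  GZK, Monsky 1994 odd} — NO `ρ(n) = 0` certificate, nothing per-curve displayed;
* DOOR B6 `…_of_genusPointData_six`: `n = 2p₁⋯p_k ≡ 6 (mod 8)`, even-Monsky kernel count `2`, `Σ₂′` odd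
  ⟹ `BSD(E_n, 2)` modulo {`tyz_genusPointData`, GZK, Monsky 1994 even};
* DOOR C6 `bsdp_two_congruentNumberCurve_two_mul_caseSix_of_genusPointData` (+ `∀`-form): Tian's class-`6`
  family, uniformly in `k`, modulo {`tyz_genusPointData`, GZK (an input of the composition only), Tian 2014
  Thm 1.3, Rédei–Reichardt};
* the `p₃·q₇` FAMILY `forall_bsdp_two_congruentNumberCurve_three_seven_of_genusPointData`: `BSD(E_{pq}, 2)`
  for ALL primes `p ≡ 3`, `q ≡ 7 (mod 8)`, modulo {`tyz_genusPointData`, GZK (composition input),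
  Rédei–Reichardt, Monsky 1990 Cor 5.15 (2)}.
These are kernel theorems MODULO the displayed facts named in their binders; the sub-lane's reach counts
for them (p2-monsky-x) are census EVIDENCE until read on the landed file, and even then pairs / families,
never classes. Nothing booked; no mark moved. Unit `b2b-bsdres-p2-typer`; NEW file.

References: [TianYuanZhang2017] §3 (Prop. 3.4, Thm. 3.5, Lemmas 3.18, 3.21), Thm 1.2, §1 (1.1);
[Tian2014] Thm 1.3, Thm 5.2; [HeathBrown1994SelmerCongruentII] Appendix (Monsky); [LiMa2008] Thm 0.4;
[Miller2011LMS] Def 1.1; HOME/p2/LEAD-OKS.md L1-65 / T-92 / T-94.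
-/

noncomputable section

open scoped Classical

open Matrix Finset WeierstrassCurve NumberField Literature.NumberTheory.EllipticCurves
  Literature.NumberTheory.EllipticCurves.Rank1Residual
  Literature.NumberTheory.EllipticCurves.Rank1Residual.Typed
  Literature.NumberTheory.EllipticCurves.Monsky1990
  Literature.NumberTheory.EllipticCurves.HeathBrown1994
  Literature.NumberTheory.EllipticCurves.TianYuanZhang2017
  Literature.NumberTheory.EllipticCurves.Tian2014
  Literature.NumberTheory.QuadraticFields.RedeiReichardt

set_option autoImplicit false

namespace Summit.BirchSwinnertonDyer.Rank1Residual.P2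

/-! ## §1 U⁺ in the doors' currency, from the displayed TYZ §3 statements and GZK -/

/-- **U⁺ DISCHARGED**: the `ρ`-free parity statement in the currency of the doors of
`P2/CongruentNumberPairsAtTwoUPlus.lean` (genus class numbers written `genusClassNumber (GenusField d)`),
from p2-monsky-lit's theorem `W2.uPlus_genusField_of` (lit-1's `gK` unfolds definitionally).
[cite: TianYuanZhang2017, Thm. 3.5 and its proof (chunks p0011 L94–L112, p0020 L107–L165, p0021 L1–L3)] -/
theorem uPlus_of_genusPointData (hTYZ : tyz_genusPointData)
    (hGZK : rank_eq_analyticRank_of_analyticRank_le_one) :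
    ∀ (n : ℕ), Squarefree n → (n % 8 = 5 ∨ n % 8 = 6 ∨ n % 8 = 7) →
      ∃ L : ℤ, IsScriptL n L ∧
        ((n % 8 = 5 ∨ n % 8 = 7) → (2 : ℤ) ∣ L →
          Even (genusSum₁ n fun d => genusClassNumber (GenusField d)) ∧
          Even (genusSum₂' n fun d => genusClassNumber (GenusField d))) ∧
        (n % 8 = 6 → (2 : ℤ) ∣ L → Even (genusSum₂' n fun d => genusClassNumber (GenusField d))) :=
  W2.uPlus_genusField_of hTYZ hGZK

/-! ## §2 DOOR A discharged (classes `5`, `7`) -/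

section DoorA

variable {k : ℕ} (p : Fin k → ℕ)

/-- **DOOR A, U⁺ DISCHARGED — rank, `Ш[2^∞]`, `BSD(E_n, 2)`.** `n = p₁⋯p_k` (distinct odd primes),
`n ≡ 5, 7 (mod 8)`, Monsky kernel count `2` (`s(n) = 1`, table route), `Σ₁(n)` odd or `Σ₂′(n)` odd over
`GenusField` ⟹ `ord_{s=1} L(E_n, s) = 1`, rank `1`, `Ш(E_n)[2^∞] = 0`, `BSD(E_n, 2)` — modulo the displayed
facts `hTYZ` (TYZ §3), `hGZK`, `hM` (Monsky 1994 odd); NO `ρ(n) = 0` input, nothing per-curve displayed.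
[cite: TianYuanZhang2017, Thm. 1.2, Thm. 3.5 and §1 (1.1)]
[cite: HeathBrown1994SelmerCongruentII, Appendix (Monsky), typescript p. 39 L10–L33]
[cite: Miller2011LMS, Def. 1.1 (arXiv:1010.2431 p. 3)] -/
theorem rankOne_sha_bsdp_two_congruentNumberCurve_of_genusPointData (hTYZ : tyz_genusPointData)
    (hGZK : rank_eq_analyticRank_of_analyticRank_le_one) (hM : monsky_card_selmerGroup_two_odd)
    (hp : ∀ i, (p i).Prime) (hodd : ∀ i, Odd (p i)) (hinj : Function.Injective p)
    {n : ℕ} (hn : ∏ i, p i = n) (h8 : n % 8 = 5 ∨ n % 8 = 7)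
    (L : Fin k → Fin k → ZMod 2) (d2 dm2 : Fin k → ZMod 2)
    (hL : ∀ i j, addLegendreSym (p j) (p i) = L i j) (h2 : ∀ i, addLegendreSym 2 (p i) = d2 i)
    (hm2 : ∀ i, addLegendreSym (-2) (p i) = dm2 i)
    (hker : Fintype.card {v : Fin k ⊕ Fin k → ZMod 2 // Matrix.fromBlocks
        (Matrix.of (fun i j => if i = j then ∑ l ∈ Finset.univ.erase i, L i l else L i j) +
          Matrix.diagonal d2) (Matrix.diagonal d2) (Matrix.diagonal d2)
        (Matrix.of (fun i j => if i = j then ∑ l ∈ Finset.univ.erase i, L i l else L i j) +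
          Matrix.diagonal dm2) *ᵥ v = 0} = 2)
    (hgen : Odd (genusSum₁ n fun d => genusClassNumber (GenusField d)) ∨
      Odd (genusSum₂' n fun d => genusClassNumber (GenusField d))) :
    (congruentNumberCurve n).analyticRank = 1 ∧ (congruentNumberCurve n).mordellWeilRank = 1 ∧
      AddCommGroup.primaryComponent (congruentNumberCurve n).sha 2 = ⊥ ∧
      BSDp (congruentNumberCurve n) 2 :=
  rankOne_sha_bsdp_two_congruentNumberCurve_of_uPlus p (uPlus_of_genusPointData hTYZ hGZK) hGZK hM hp
    hodd hinj hn h8 L d2 dm2 hL h2 hm2 hker hgen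

/-- **DOOR A, U⁺ DISCHARGED — `BSD(E_n, 2)`** (the `ρ`-free twin of
`bsdp_two_congruentNumberCurve_of_genus''`: same inputs minus `hρ`, fact `hTYZ` in place of `h12`).
[cite: TianYuanZhang2017, Thm. 1.2, Thm. 3.5 and §1 (1.1)] [cite: Miller2011LMS, Def. 1.1 (arXiv:1010.2431 p. 3)] -/
theorem bsdp_two_congruentNumberCurve_of_genusPointData (hTYZ : tyz_genusPointData)
    (hGZK : rank_eq_analyticRank_of_analyticRank_le_one) (hM : monsky_card_selmerGroup_two_odd)
    (hp : ∀ i, (p i).Prime) (hodd : ∀ i, Odd (p i)) (hinj : Function.Injective p)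
    {n : ℕ} (hn : ∏ i, p i = n) (h8 : n % 8 = 5 ∨ n % 8 = 7)
    (L : Fin k → Fin k → ZMod 2) (d2 dm2 : Fin k → ZMod 2)
    (hL : ∀ i j, addLegendreSym (p j) (p i) = L i j) (h2 : ∀ i, addLegendreSym 2 (p i) = d2 i)
    (hm2 : ∀ i, addLegendreSym (-2) (p i) = dm2 i)
    (hker : Fintype.card {v : Fin k ⊕ Fin k → ZMod 2 // Matrix.fromBlocks
        (Matrix.of (fun i j => if i = j then ∑ l ∈ Finset.univ.erase i, L i l else L i j) +
          Matrix.diagonal d2) (Matrix.diagonal d2) (Matrix.diagonal d2)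
        (Matrix.of (fun i j => if i = j then ∑ l ∈ Finset.univ.erase i, L i l else L i j) +
          Matrix.diagonal dm2) *ᵥ v = 0} = 2)
    (hgen : Odd (genusSum₁ n fun d => genusClassNumber (GenusField d)) ∨
      Odd (genusSum₂' n fun d => genusClassNumber (GenusField d))) :
    BSDp (congruentNumberCurve n) 2 :=
  bsdp_two_congruentNumberCurve_of_uPlus p (uPlus_of_genusPointData hTYZ hGZK) hGZK hM hp hodd hinj hn
    h8 L d2 dm2 hL h2 hm2 hker hgen

end DoorA

/-! ## §3 DOOR B6 discharged (class `6`) -/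

section DoorB6

variable {k : ℕ} (p : Fin k → ℕ)

/-- **DOOR B6, U⁺ DISCHARGED — rank, `Ш[2^∞]`, `BSD(E_n, 2)`** for `n = 2p₁⋯p_k ≡ 6 (mod 8)` with
even-Monsky kernel count `2` and `Σ₂′(n)` odd, modulo `hTYZ`, `hGZK`, `hMe` (Monsky 1994 even); nothing
per-curve displayed. [cite: TianYuanZhang2017, Thm. 1.2, Thm. 3.5 and §1 (1.1)]
[cite: HeathBrown1994SelmerCongruentII, Appendix (Monsky), typescript p. 41 L20–L36]
[cite: Miller2011LMS, Def. 1.1 (arXiv:1010.2431 p. 3)] -/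
theorem rankOne_sha_bsdp_two_congruentNumberCurve_of_genusPointData_six (hTYZ : tyz_genusPointData)
    (hGZK : rank_eq_analyticRank_of_analyticRank_le_one) (hMe : monsky_card_selmerGroup_two_even)
    (hp : ∀ i, (p i).Prime) (hodd : ∀ i, Odd (p i)) (hinj : Function.Injective p)
    {n : ℕ} (hn : 2 * ∏ i, p i = n) (h8 : n % 8 = 6)
    (L : Fin k → Fin k → ZMod 2) (d2 dm1 : Fin k → ZMod 2)
    (hL : ∀ i j, addLegendreSym (p j) (p i) = L i j) (h2 : ∀ i, addLegendreSym 2 (p i) = d2 i)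
    (hm1 : ∀ i, addLegendreSym (-1) (p i) = dm1 i)
    (hker : Fintype.card {v : Fin k ⊕ Fin k → ZMod 2 // Matrix.fromBlocks
        ((Matrix.of (fun i j => if i = j then ∑ l ∈ Finset.univ.erase i, L i l else L i j))ᵀ +
          Matrix.diagonal d2) (Matrix.diagonal dm1) (Matrix.diagonal d2)
        (Matrix.of (fun i j => if i = j then ∑ l ∈ Finset.univ.erase i, L i l else L i j) +
          Matrix.diagonal d2) *ᵥ v = 0} = 2)
    (hgen : Odd (genusSum₂' n fun d => genusClassNumber (GenusField d))) :
    (congruentNumberCurve n).analyticRank = 1 ∧ (congruentNumberCurve n).mordellWeilRank = 1 ∧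
      AddCommGroup.primaryComponent (congruentNumberCurve n).sha 2 = ⊥ ∧
      BSDp (congruentNumberCurve n) 2 :=
  rankOne_sha_bsdp_two_congruentNumberCurve_of_uPlus_six p (uPlus_of_genusPointData hTYZ hGZK) hGZK hMe
    hp hodd hinj hn h8 L d2 dm1 hL h2 hm1 hker hgen

/-- **DOOR B6, U⁺ DISCHARGED — `BSD(E_n, 2)`**, modulo `hTYZ`, `hGZK`, `hMe` and nothing else.
[cite: TianYuanZhang2017, Thm. 1.2, Thm. 3.5 and §1 (1.1)] [cite: Miller2011LMS, Def. 1.1 (arXiv:1010.2431 p. 3)] -/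
theorem bsdp_two_congruentNumberCurve_of_genusPointData_six (hTYZ : tyz_genusPointData)
    (hGZK : rank_eq_analyticRank_of_analyticRank_le_one) (hMe : monsky_card_selmerGroup_two_even)
    (hp : ∀ i, (p i).Prime) (hodd : ∀ i, Odd (p i)) (hinj : Function.Injective p)
    {n : ℕ} (hn : 2 * ∏ i, p i = n) (h8 : n % 8 = 6)
    (L : Fin k → Fin k → ZMod 2) (d2 dm1 : Fin k → ZMod 2)
    (hL : ∀ i j, addLegendreSym (p j) (p i) = L i j) (h2 : ∀ i, addLegendreSym 2 (p i) = d2 i)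
    (hm1 : ∀ i, addLegendreSym (-1) (p i) = dm1 i)
    (hker : Fintype.card {v : Fin k ⊕ Fin k → ZMod 2 // Matrix.fromBlocks
        ((Matrix.of (fun i j => if i = j then ∑ l ∈ Finset.univ.erase i, L i l else L i j))ᵀ +
          Matrix.diagonal d2) (Matrix.diagonal dm1) (Matrix.diagonal d2)
        (Matrix.of (fun i j => if i = j then ∑ l ∈ Finset.univ.erase i, L i l else L i j) +
          Matrix.diagonal d2) *ᵥ v = 0} = 2)
    (hgen : Odd (genusSum₂' n fun d => genusClassNumber (GenusField d))) :
    BSDp (congruentNumberCurve n) 2 :=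
  bsdp_two_congruentNumberCurve_of_uPlus_six p (uPlus_of_genusPointData hTYZ hGZK) hGZK hMe hp hodd hinj
    hn h8 L d2 dm1 hL h2 hm1 hker hgen

end DoorB6

/-! ## §4 DOOR C6 discharged (Tian's class-`6` family) -/

section DoorC6

variable {k : ℕ} (p : Fin (k + 1) → ℕ)

/-- **DOOR C6, U⁺ DISCHARGED — `BSD(E_{2n}, 2)` ON TIAN'S CLASS-`6` FAMILY**, uniformly in `k`:
`n = p₀p₁⋯p_k` (distinct primes, `p₀ ≡ 3 (mod 4)`, `pᵢ ≡ 1 (mod 8)`, odd Legendre graph) ⟹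
`BSD(E_{2n}, 2)`, modulo `hTYZ` (TYZ §3 displayed), `hGZK` (input of the U⁺ composition only), `h13`
(Tian 2014 Thm 1.3), `hR` (Rédei–Reichardt); no Monsky matrix, nothing per-curve.
[cite: Tian2014, Thm. 1.3, Lemma 5.1, Thm. 5.2 (arXiv p. 2 L5–L15; p. 28 L2–L16, L40–L43)]
[cite: TianYuanZhang2017, Thm. 1.2, Thm. 3.5 and §1 (1.1)] [cite: LiMa2008, Thm. 0.4]
[cite: Miller2011LMS, Def. 1.1 (arXiv:1010.2431 p. 3)] -/
theorem bsdp_two_congruentNumberCurve_two_mul_caseSix_of_genusPointData (hTYZ : tyz_genusPointData)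
    (hGZK : rank_eq_analyticRank_of_analyticRank_le_one) (h13 : thm13_rank_one_and_sha_odd)
    (hR : redeiReichardt_fourTwoCard_classGroup)
    (hp : ∀ i, (p i).Prime) (hinj : Function.Injective p) (h3 : p 0 % 4 = 3)
    (h1 : ∀ i, i ≠ 0 → p i % 8 = 1) (hG : ∀ v, legendreMatrix p *ᵥ v = 0 → v = 0 ∨ v = fun _ => 1)
    {n : ℕ} (hn : ∏ i, p i = n) :
    BSDp (congruentNumberCurve (2 * n)) 2 :=
  bsdp_two_congruentNumberCurve_two_mul_caseSix p (uPlus_of_genusPointData hTYZ hGZK) h13 hR hp hinj h3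
    h1 hG hn

/-- **`BSD(E_{2n}, 2)` for EVERY member of Tian's class-`6` family, U⁺ DISCHARGED** (`∀`-form), modulo
`hTYZ`, `hGZK`, `h13`, `hR`; no per-curve input.
[cite: Tian2014, Thm. 1.3 and Thm. 5.2 (arXiv p. 2 L5–L15; p. 28 L40–L43)]
[cite: TianYuanZhang2017, Thm. 1.2 and Thm. 3.5] [cite: Miller2011LMS, Def. 1.1 (arXiv:1010.2431 p. 3)] -/
theorem forall_bsdp_two_congruentNumberCurve_two_mul_caseSix_of_genusPointData
    (hTYZ : tyz_genusPointData) (hGZK : rank_eq_analyticRank_of_analyticRank_le_one)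
    (h13 : thm13_rank_one_and_sha_odd) (hR : redeiReichardt_fourTwoCard_classGroup) :
    ∀ (k : ℕ) (p : Fin (k + 1) → ℕ), (∀ i, (p i).Prime) → Function.Injective p → p 0 % 4 = 3 →
      (∀ i, i ≠ 0 → p i % 8 = 1) → (∀ v, legendreMatrix p *ᵥ v = 0 → v = 0 ∨ v = fun _ => 1) →
      BSDp (congruentNumberCurve (2 * ∏ i, p i)) 2 :=
  forall_bsdp_two_congruentNumberCurve_two_mul_caseSix (uPlus_of_genusPointData hTYZ hGZK) h13 hR

end DoorC6

/-! ## §5 The `p₃·q₇` family discharged -/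

/-- **THE TWO-PRIME FAMILY `p₃·q₇`, U⁺ DISCHARGED**: for primes `p ≡ 3`, `q ≡ 7 (mod 8)`,
`ord_{s=1} L(E_{pq}, s) = 1` and `BSD(E_{pq}, 2)`, modulo `hTYZ` (TYZ §3 displayed), `hGZK` (input of the U⁺
composition only), `hR` (Rédei–Reichardt), `h515` (Monsky 1990 Cor 5.15 (2)); nothing per-curve.
[cite: TianYuanZhang2017, Thm. 1.2, Thm. 3.5 and §1 (1.1)] [cite: Monsky1990MockHeegner, Cor. 5.15 (2) (p. 66)]
[cite: Miller2011LMS, Def. 1.1 (arXiv:1010.2431 p. 3)] -/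
theorem bsdp_two_congruentNumberCurve_three_seven_of_genusPointData (hTYZ : tyz_genusPointData)
    (hGZK : rank_eq_analyticRank_of_analyticRank_le_one) (hR : redeiReichardt_fourTwoCard_classGroup)
    (h515 : cor515_rank_eq_one_and_card_selmerGroup_two)
    {p q : ℕ} (hp : p.Prime) (hq : q.Prime) (hp3 : p % 8 = 3) (hq7 : q % 8 = 7) :
    haveI := isElliptic_congruentNumberCurve (Nat.mul_ne_zero hp.ne_zero hq.ne_zero)
    (congruentNumberCurve (p * q)).analyticRank = 1 ∧ BSDp (congruentNumberCurve (p * q)) 2 :=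
  bsdp_two_congruentNumberCurve_three_seven (uPlus_of_genusPointData hTYZ hGZK) hR h515 hp hq hp3 hq7

/-- **`BSD(E_{pq}, 2)` for ALL primes `p ≡ 3`, `q ≡ 7 (mod 8)`, U⁺ DISCHARGED**, modulo `hTYZ`, `hGZK`,
`hR`, `h515`; no per-curve input. [cite: TianYuanZhang2017, Thm. 1.2, Thm. 3.5 and §1 (1.1)]
[cite: Monsky1990MockHeegner, Cor. 5.15 (2) (p. 66)] [cite: Miller2011LMS, Def. 1.1 (arXiv:1010.2431 p. 3)] -/
theorem forall_bsdp_two_congruentNumberCurve_three_seven_of_genusPointData (hTYZ : tyz_genusPointData)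
    (hGZK : rank_eq_analyticRank_of_analyticRank_le_one) (hR : redeiReichardt_fourTwoCard_classGroup)
    (h515 : cor515_rank_eq_one_and_card_selmerGroup_two) :
    ∀ p q : ℕ, p.Prime → q.Prime → p % 8 = 3 → q % 8 = 7 → BSDp (congruentNumberCurve (p * q)) 2 :=
  forall_bsdp_two_congruentNumberCurve_three_seven (uPlus_of_genusPointData hTYZ hGZK) hR h515

end Summit.BirchSwinnertonDyer.Rank1Residual.P2


end
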